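import Literature.NumberTheory.EllipticCurves.QuadraticSelmerStructure
import HarnessLib

/-!
# KMR Lemma 3.4 abstractly: in characteristic `≠ 2` the Tate quadratic forms are `q_v = ½⟨x, x⟩_v`,
# and a global metabolic structure is BILINEAR data (cell `b2b-bsdres`, unit `b2b-bsdres-x10` =
# N2 class lead, GEN 30; TOOL — definitions with bodies and theorems over ABSTRACT data; no named
# fact; nothing booked; companion of `X10/SelmerStructureSum`, `X10/ResidualSelmerParity`,
# `X10/ResidualSelmerGeneratorTest`)

HONEST FRAMING (run/shared/lean/b2b/bsd-rank1-residual/, verbatim in every file): the goal of the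
cell is to DELETE the COMBINATION-SHAPED residual classes of the Birch–Swinnerton-Dyer formula for
ALL analytic-rank `≤ 1` elliptic curves over `ℚ` — "full BSD formula for every rank `≤ 1` curve in
class `C`" assembled STRICTLY from published theorems — so that the rank-`≤ 1` remainder becomes
exactly the CONSTRUCTION-SHAPED classes, which are TYPED (missing-input `Prop`s), NOT attempted.
This is not "finishing BSD". Class X10b (= N2) keeps its label CONSTRUCTION-SHAPED (NEEDS `X_A3`,
referee R82.3 / RESIDUAL-MAP §I N2); this file is a TOOL; no mark / label / tier / count moves.

## What

The N2 parity laws are proved abstractly (x10 GEN 30, files 1–3) for quadratic Selmer structures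
of a `GlobalMetabolicStructure 𝓆` (Klagsbrun–Mazur–Rubin 2013 Def. 3.3, tree file
`Literature/NumberTheory/EllipticCurves/QuadraticSelmerStructure.lean`), whose datum is a family of
QUADRATIC forms. For an ODD prime `p` the arithmetic instance never sees a quadratic form: Klagsbrun–
Mazur–Rubin 2013, **Lemma 3.4** — "If `p > 2` then there is a unique Tate quadratic form `q_v` on
`H¹(K_v, T)` for every `v`, and a unique global metabolic structure on `T`", proof: "`q_v(x) := ½⟨x, x⟩_v`;
if `v ∉ Σ` then `q_v` is unramified by Theorem 3.1 (ii), and if `c ∈ H¹(K, T)` then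
`∑_v q_v(c_v) = ½ ∑_v ⟨c_v, c_v⟩_v = 0` by Theorem 3.1 (iii)" — and a subspace is Lagrangian for
`½⟨x, x⟩` iff it is its own orthogonal complement (Mazur–Rubin 2007 Def. 1.2: "self-dual"). This file
is that lemma over ABSTRACT data, for any field `F` with `2 ≠ 0` (e.g. `𝔽_p`, `p` odd: the
tree's `Literature.NumberTheory.EllipticCurves.BinaryQuartic.two_ne_zero_zmod`, not re-declared here):

* §1 `halfQuadraticForm b` = `x ↦ ½ b(x, x)` for a bilinear form `b`; for SYMMETRIC `b`:
  `polarForm_halfQuadraticForm` (its polar form is `b` — KMR Def. 3.2 "Tate quadratic form"),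
  `isLagrangian_halfQuadraticForm_iff` (Lagrangian ⟺ `b`-self-orthogonal `X^⊥ = X`),
  `isMetabolic_halfQuadraticForm` (nondegenerate + a self-orthogonal subspace ⟹ metabolic).
* §2 `GlobalMetabolicStructure.ofPairings` — a global metabolic structure from BILINEAR local data:
  symmetric nondegenerate `b v` on each `L v` admitting a self-orthogonal subspace, `Λ v`
  self-orthogonal off `S₀` (KMR Thm. 3.1 (ii)), and the finitary reciprocity
  `∑_{v ∈ S} b_v(loc_v c, loc_v c) = 0` for `c` unramified outside `S ⊇ S₀` (KMR Thm. 3.1 (iii));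
  `ofPairings_isTateFor` (its forms are Tate for `b`, KMR Def. 3.2); `polarForm_piForm_ofPairings`
  (the sum form's polar form is `∑_v b_v`) and `isSelfDualAt_ofPairings_iff` (the Poitou–Tate input
  `IsSelfDualAt S` in bilinear words: `y ⊥_b Z ⟺ y ∈ Z` for `Z = loc_S(H_S)`).
* §3 `QuadraticSelmerStructure.ofSelfDual` — a quadratic Selmer structure of `ofPairings …` from a
  family of `b`-SELF-ORTHOGONAL local conditions on a finite `S ⊇ S₀` (MR07 Def. 1.2 "self-dual
  Selmer structure"), with its `W`/`places` unfolding lemmas.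

So the E[p] instance of files 1–3 (P-SPEC (I1)–(I6); `HOME/class-closure/N2/P-INSTANCE-SPEC-x10g30.md`)
needs only BILINEAR inputs, all in the currency the tree already has: the local Tate pairings
`localTatePairingZMod` composed with the Weil self-duality `E[p] ≅ E[p]^∨(1)` (symmetric,
nondegenerate: KMR Thm. 3.1 (i), tree `exists_perfectPairing_galoisCohomology_tateDual` / `IsPerfect`),
`H¹_ur` self-orthogonal at `v ∤ p` (n1011 `UnramifiedCup.unramifiedOrthogonal_of_isPerfect`,
`cupProduct_eq_zero_of_mem_unramifiedSubgroup`), the sum formula (`SumLocalTermEqZero` of the tree's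
Poitou–Tate fact), the Kummer conditions self-orthogonal (KMR Lemma 5.3 / MR07 Prop. 2.1; isotropy =
tree fact `kummerClass_cupProduct_kummerClass_eq_zero`), and `Z^⊥ = Z` (`SelmerComplement`). Nothing
of that is claimed or built here.

## References

* [KlagsbrunMazurRubin2013] Z. Klagsbrun, B. Mazur, K. Rubin, *Disparity in Selmer ranks of
  quadratic twists of elliptic curves*, Ann. of Math. 178 (2013), Thm. 3.1, Def. 3.2, Def. 3.3,
  Lemma 3.4, Def. 3.8 — arXiv:1111.2321 p. 7, read.
* [MazurRubin2007] B. Mazur, K. Rubin, *Finding large Selmer rank via an arithmetic theory of local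
  constants*, Ann. of Math. 166 (2007), Thm. 1.1, Def. 1.2 — arXiv:math/0512085 p. 5, read.
-/

set_option autoImplicit false

noncomputable section

open Module QuadraticMap Literature.LinearAlgebra.QuadraticForm Literature.NumberTheory.EllipticCurves

namespace Summit.BirchSwinnertonDyer.Rank1Residual.X10.TateQuadraticFormsOdd

universe u v w x

/-! ### §1. `q = ½ b(x, x)` for a symmetric bilinear form `b` in characteristic `≠ 2` -/

section Half

variable {F : Type u} [Field F] {V : Type v} [AddCommGroup V] [Module F V]

/-- **The Tate quadratic form of a pairing in characteristic `≠ 2`**: `q(x) = ½ b(x, x)`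
(Klagsbrun–Mazur–Rubin 2013, proof of Lemma 3.4: "`q_v(x) := ½⟨x, x⟩_v`").
[cite: KlagsbrunMazurRubin2013, Lemma 3.4 (proof)] -/
def halfQuadraticForm (b : LinearMap.BilinForm F V) : QuadraticForm F V :=
  LinearMap.BilinMap.toQuadraticMap ((2 : F)⁻¹ • b)

/-- `q(x) = ½ b(x, x)`. [cite: KlagsbrunMazurRubin2013, Lemma 3.4 (proof)] -/
@[simp] theorem halfQuadraticForm_apply (b : LinearMap.BilinForm F V) (x : V) :
    halfQuadraticForm b x = (2 : F)⁻¹ * b x x := rfl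

/-- For symmetric `b` and `2 ≠ 0`, the polar form of `½ b(x, x)` is `b`: `q` is a TATE quadratic form
for `b` (KMR Def. 3.2: "the bilinear form induced by `q` is `⟨ , ⟩_v`"; uniqueness half of Lemma 3.4).
[cite: KlagsbrunMazurRubin2013, Def. 3.2 and Lemma 3.4] -/
theorem polarForm_halfQuadraticForm {b : LinearMap.BilinForm F V} (hb : b.IsSymm) (h2 : (2 : F) ≠ 0) :
    polarForm (halfQuadraticForm b) = b := by
  ext x y
  rw [polarForm_apply, halfQuadraticForm, LinearMap.BilinMap.polar_toQuadraticMap,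
    LinearMap.smul_apply, LinearMap.smul_apply, LinearMap.smul_apply, LinearMap.smul_apply,
    hb.eq y x, smul_eq_mul, ← two_mul, ← mul_assoc, mul_inv_cancel₀ h2, one_mul]

/-- A `b`-self-orthogonal subspace is totally isotropic for `½ b(x, x)` (`x ∈ X = X^⊥ ⟹ b(x, x) = 0`).
[cite: KlagsbrunMazurRubin2013, Lemma 3.4 (proof)] -/
theorem isTotallyIsotropic_halfQuadraticForm_of_orthogonal_eq {b : LinearMap.BilinForm F V}
    {X : Submodule F V} (hX : b.orthogonal X = X) : IsTotallyIsotropic (halfQuadraticForm b) X := by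
  intro x hx
  have hx' : x ∈ b.orthogonal X := hX.symm ▸ hx
  rw [halfQuadraticForm_apply, (LinearMap.BilinForm.mem_orthogonal_iff.mp hx') x hx, mul_zero]

/-- **Lagrangian ⟺ self-orthogonal** for `q = ½ b(x, x)`, `b` symmetric, `2 ≠ 0`: KMR's Lagrangian
subspaces (Def. 2.1) for the Tate form of an odd `p` are exactly Mazur–Rubin 2007's SELF-DUAL local
conditions (Def. 1.2: "`H¹_𝓕(K_v, T)` is its own orthogonal complement under the Tate pairing").
[cite: KlagsbrunMazurRubin2013, Def. 2.1 and Lemma 3.4] [cite: MazurRubin2007, Def. 1.2] -/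
theorem isLagrangian_halfQuadraticForm_iff {b : LinearMap.BilinForm F V} (hb : b.IsSymm)
    (h2 : (2 : F) ≠ 0) (X : Submodule F V) :
    IsLagrangian (halfQuadraticForm b) X ↔ b.orthogonal X = X := by
  rw [IsLagrangian, polarForm_halfQuadraticForm hb h2]
  exact ⟨fun h => h.1, fun h => ⟨h, isTotallyIsotropic_halfQuadraticForm_of_orthogonal_eq h⟩⟩

/-- **Metabolic from bilinear data**: `b` symmetric nondegenerate with SOME self-orthogonal subspace
⟹ `(V, ½ b(x, x))` is a metabolic space (KMR Def. 2.1 / Def. 3.3 (i); in the instance the Kummer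
image or `H¹_ur` is such a subspace). [cite: KlagsbrunMazurRubin2013, Def. 2.1 and Lemma 3.4] -/
theorem isMetabolic_halfQuadraticForm {b : LinearMap.BilinForm F V} (hb : b.IsSymm) (h2 : (2 : F) ≠ 0)
    (hnd : b.Nondegenerate) (hex : ∃ X : Submodule F V, b.orthogonal X = X) :
    IsMetabolic (halfQuadraticForm b) := by
  obtain ⟨X, hX⟩ := hex
  refine ⟨?_, X, (isLagrangian_halfQuadraticForm_iff hb h2 X).mpr hX⟩
  rw [polarForm_halfQuadraticForm hb h2]
  exact hnd

end Half

/-! ### §2. KMR Lemma 3.4: a global metabolic structure from symmetric local pairings -/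

section Global

variable {F : Type u} [Field F] {ι : Type v} {H : Type w} [AddCommGroup H] [Module F H]
  {L : ι → Type x} [∀ v, AddCommGroup (L v)] [∀ v, Module F (L v)]
  (loc : ∀ v, H →ₗ[F] L v) (Λ : ∀ v, Submodule F (L v)) (S₀ : Finset ι)
  (b : ∀ v, LinearMap.BilinForm F (L v))

/-- **KMR Lemma 3.4 over abstract data.** In characteristic `≠ 2`, symmetric nondegenerate local
pairings `b v` on `L v` (KMR Thm. 3.1 (i)), each admitting a self-orthogonal subspace, with `Λ v`
self-orthogonal off `S₀` (Thm. 3.1 (ii): "`H¹_ur(K_v, T)` is equal to its own orthogonal complement")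
and the finitary reciprocity `∑_{v ∈ S} b_v(loc_v c, loc_v c) = 0` for `c` unramified outside
`S ⊇ S₀` (Thm. 3.1 (iii): "`∑_v ⟨c_v, d_v⟩_v = 0`", the terms off `S` vanishing by (ii)), give the
global metabolic structure `𝓆 = (½ b_v(x, x))_v` (Lemma 3.4: "… and a unique global metabolic
structure on `T`"). [cite: KlagsbrunMazurRubin2013, Lemma 3.4] [cite: KlagsbrunMazurRubin2013, Thm. 3.1] -/
def GlobalMetabolicStructure.ofPairings (hsymm : ∀ v, (b v).IsSymm) (h2 : (2 : F) ≠ 0)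
    (hnd : ∀ v, (b v).Nondegenerate) (hex : ∀ v, ∃ X : Submodule F (L v), (b v).orthogonal X = X)
    (hΛ : ∀ v, v ∉ S₀ → (b v).orthogonal (Λ v) = Λ v)
    (hsum : ∀ S : Finset ι, S₀ ⊆ S → ∀ c : H, (∀ v, v ∉ S → loc v c ∈ Λ v) →
      ∑ v ∈ S, b v (loc v c) (loc v c) = 0) :
    GlobalMetabolicStructure loc Λ S₀ where
  form v := halfQuadraticForm (b v)
  isMetabolic v := isMetabolic_halfQuadraticForm (hsymm v) h2 (hnd v) (hex v)
  isLagrangian_unramified v hv := (isLagrangian_halfQuadraticForm_iff (hsymm v) h2 _).mpr (hΛ v hv)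
  sum_eq_zero S hS c hc := by
    simp only [halfQuadraticForm_apply, ← Finset.mul_sum, hsum S hS c hc, mul_zero]

variable {loc Λ S₀ b} (hsymm : ∀ v, (b v).IsSymm) (h2 : (2 : F) ≠ 0)
  (hnd : ∀ v, (b v).Nondegenerate) (hex : ∀ v, ∃ X : Submodule F (L v), (b v).orthogonal X = X)
  (hΛ : ∀ v, v ∉ S₀ → (b v).orthogonal (Λ v) = Λ v)
  (hsum : ∀ S : Finset ι, S₀ ⊆ S → ∀ c : H, (∀ v, v ∉ S → loc v c ∈ Λ v) →
    ∑ v ∈ S, b v (loc v c) (loc v c) = 0)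

/-- The forms of `ofPairings` are `½ b_v(x, x)`. [cite: KlagsbrunMazurRubin2013, Lemma 3.4] -/
@[simp] theorem ofPairings_form (v : ι) :
    (GlobalMetabolicStructure.ofPairings loc Λ S₀ b hsymm h2 hnd hex hΛ hsum).form v =
      halfQuadraticForm (b v) := rfl

/-- The forms of `ofPairings` are TATE quadratic forms for `b` (KMR Def. 3.2).
[cite: KlagsbrunMazurRubin2013, Def. 3.2 and Lemma 3.4] -/
theorem ofPairings_isTateFor :
    (GlobalMetabolicStructure.ofPairings loc Λ S₀ b hsymm h2 hnd hex hΛ hsum).IsTateFor b :=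
  fun v => polarForm_halfQuadraticForm (hsymm v) h2

/-- Lagrangian for `ofPairings` at `v` ⟺ `b v`-self-orthogonal.
[cite: KlagsbrunMazurRubin2013, Lemma 3.4] [cite: MazurRubin2007, Def. 1.2] -/
theorem isLagrangian_ofPairings_iff (v : ι) (X : Submodule F (L v)) :
    IsLagrangian ((GlobalMetabolicStructure.ofPairings loc Λ S₀ b hsymm h2 hnd hex hΛ hsum).form v) X ↔
      (b v).orthogonal X = X :=
  isLagrangian_halfQuadraticForm_iff (hsymm v) h2 X

/-- The polar form of the sum form `q_S = ∑_{v ∈ S} ½ b_v(x_v, x_v)` on `⊕_{v ∈ S} L v` is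
`∑_{v ∈ S} b_v(x_v, y_v)` (the pairing "(derlp)" of MR07's proof of Prop. 1.3).
[cite: KlagsbrunMazurRubin2013, Thm. 3.9 (proof)] [cite: MazurRubin2007, Prop. 1.3 (proof)] -/
theorem polarForm_piForm_ofPairings (S : Finset ι) (x y : ∀ v : S, L v) :
    polarForm ((GlobalMetabolicStructure.ofPairings loc Λ S₀ b hsymm h2 hnd hex hΛ hsum).piForm S) x y =
      ∑ v : S, b v (x v) (y v) := by
  rw [GlobalMetabolicStructure.piForm, polarForm_pi_apply]
  exact Finset.sum_congr rfl fun v _ => by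
    rw [ofPairings_form, polarForm_halfQuadraticForm (hsymm v) h2]

/-- **The Poitou–Tate input in bilinear words.** `ofPairings … |>.IsSelfDualAt S` ⟺ for every
`y ∈ ⊕_{v ∈ S} L v`: `(∑_{v ∈ S} b_v(z_v, y_v) = 0 for all z ∈ Z) ⟺ y ∈ Z`, where
`Z = loc_S(H_S)` is the image of the classes unramified outside `S` (KMR, proof of Thm. 3.9: "We have
`Z^⊥ = Z` by Poitou–Tate global duality"; MR07, proof of Prop. 1.3: "`C` is its own orthogonal
complement"; in the tree's currency: `SelmerComplement` / `SumLocalTermEqZero`).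
[cite: KlagsbrunMazurRubin2013, Thm. 3.9 (proof)] [cite: MazurRubin2007, Prop. 1.3 (proof)] -/
theorem isSelfDualAt_ofPairings_iff (S : Finset ι) :
    (GlobalMetabolicStructure.ofPairings loc Λ S₀ b hsymm h2 hnd hex hΛ hsum).IsSelfDualAt S ↔
      ∀ y : ∀ v : S, L v,
        (∀ z ∈ globalImage loc Λ S, ∑ v : S, b v (z v) (y v) = 0) ↔ y ∈ globalImage loc Λ S := by
  rw [GlobalMetabolicStructure.IsSelfDualAt, SetLike.ext_iff]
  refine forall_congr' fun y => ?_
  rw [LinearMap.BilinForm.mem_orthogonal_iff]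
  refine Iff.of_eq (congrArg (fun P : Prop => (P ↔ y ∈ globalImage loc Λ S)) (propext ?_))
  refine forall₂_congr fun z _ => ?_
  rw [polarForm_piForm_ofPairings]

end Global

/-! ### §3. Self-dual local conditions (MR07 Def. 1.2) as quadratic Selmer structures -/

section SelfDual

variable {F : Type u} [Field F] {ι : Type v} [DecidableEq ι] {H : Type w} [AddCommGroup H]
  [Module F H] {L : ι → Type x} [∀ v, AddCommGroup (L v)] [∀ v, Module F (L v)]
  {loc : ∀ v, H →ₗ[F] L v} {Λ : ∀ v, Submodule F (L v)} {S₀ : Finset ι}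
  {b : ∀ v, LinearMap.BilinForm F (L v)} (hsymm : ∀ v, (b v).IsSymm) (h2 : (2 : F) ≠ 0)
  (hnd : ∀ v, (b v).Nondegenerate) (hex : ∀ v, ∃ X : Submodule F (L v), (b v).orthogonal X = X)
  (hΛ : ∀ v, v ∉ S₀ → (b v).orthogonal (Λ v) = Λ v)
  (hsum : ∀ S : Finset ι, S₀ ⊆ S → ∀ c : H, (∀ v, v ∉ S → loc v c ∈ Λ v) →
    ∑ v ∈ S, b v (loc v c) (loc v c) = 0)

/-- **A self-dual Selmer structure (MR07 Def. 1.2) is a quadratic Selmer structure for `½⟨x, x⟩`**: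
from `b_v`-SELF-ORTHOGONAL local conditions `X v` on a finite `S ⊇ S₀` (extended by `Λ v` off `S`,
KMR Def. 3.8). THE INSTANCE: `X v` = the local Kummer conditions of `E[p]` ("Tate's local duality
shows that `𝓔` is self-dual", MR07 Prop. 2.1; KMR Lemma 5.3), `S` = places above `p`, archimedean and
bad places. [cite: MazurRubin2007, Def. 1.2] [cite: KlagsbrunMazurRubin2013, Def. 3.8 and Lemma 3.4] -/
def QuadraticSelmerStructure.ofSelfDual (S : Finset ι) (hS : S₀ ⊆ S) (X : ∀ v, Submodule F (L v))
    (hX : ∀ v, v ∈ S → (b v).orthogonal (X v) = X v) :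
    QuadraticSelmerStructure (GlobalMetabolicStructure.ofPairings loc Λ S₀ b hsymm h2 hnd hex hΛ hsum) :=
  QuadraticSelmerStructure.ofLagrangians S hS X fun v hv =>
    (isLagrangian_halfQuadraticForm_iff (hsymm v) h2 _).mpr (hX v hv)

/-- `Σ_{ofSelfDual} = S`. [cite: KlagsbrunMazurRubin2013, Def. 3.8] -/
@[simp] theorem ofSelfDual_places (S : Finset ι) (hS : S₀ ⊆ S) (X : ∀ v, Submodule F (L v))
    (hX : ∀ v, v ∈ S → (b v).orthogonal (X v) = X v) :
    (QuadraticSelmerStructure.ofSelfDual hsymm h2 hnd hex hΛ hsum S hS X hX).places = S := rfl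

/-- On `S` the local condition of `ofSelfDual` is the given one. [cite: KlagsbrunMazurRubin2013, Def. 3.8] -/
@[simp] theorem ofSelfDual_W_of_mem (S : Finset ι) (hS : S₀ ⊆ S) (X : ∀ v, Submodule F (L v))
    (hX : ∀ v, v ∈ S → (b v).orthogonal (X v) = X v) {v : ι} (hv : v ∈ S) :
    (QuadraticSelmerStructure.ofSelfDual hsymm h2 hnd hex hΛ hsum S hS X hX).W v = X v :=
  QuadraticSelmerStructure.ofLagrangians_W_of_mem hS _ hv

/-- Off `S` the local condition of `ofSelfDual` is `Λ v`. [cite: KlagsbrunMazurRubin2013, Def. 3.8] -/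
@[simp] theorem ofSelfDual_W_of_not_mem (S : Finset ι) (hS : S₀ ⊆ S) (X : ∀ v, Submodule F (L v))
    (hX : ∀ v, v ∈ S → (b v).orthogonal (X v) = X v) {v : ι} (hv : v ∉ S) :
    (QuadraticSelmerStructure.ofSelfDual hsymm h2 hnd hex hΛ hsum S hS X hX).W v = Λ v :=
  QuadraticSelmerStructure.ofLagrangians_W_of_not_mem hS _ hv

/-- For `ofSelfDual` the Selmer group is cut out by the given conditions on `S` and by `Λ v` off `S`
(MR07 Def. 1.2: "`H¹_𝓕(K, T)` is the collection of classes whose localizations lie in `H¹_𝓕(K_v, T)`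
for every `v`"). [cite: MazurRubin2007, Def. 1.2] -/
theorem mem_selmerGroup_ofSelfDual_iff (S : Finset ι) (hS : S₀ ⊆ S) (X : ∀ v, Submodule F (L v))
    (hX : ∀ v, v ∈ S → (b v).orthogonal (X v) = X v) (c : H) :
    c ∈ (QuadraticSelmerStructure.ofSelfDual hsymm h2 hnd hex hΛ hsum S hS X hX).selmerGroup ↔
      (∀ v ∈ S, loc v c ∈ X v) ∧ ∀ v, v ∉ S → loc v c ∈ Λ v := by
  rw [QuadraticSelmerStructure.mem_selmerGroup_iff]
  refine ⟨fun h => ⟨fun v hv => ?_, fun v hv => ?_⟩, fun h v => ?_⟩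
  · simpa only [ofSelfDual_W_of_mem hsymm h2 hnd hex hΛ hsum S hS X hX hv] using h v
  · simpa only [ofSelfDual_W_of_not_mem hsymm h2 hnd hex hΛ hsum S hS X hX hv] using h v
  · by_cases hv : v ∈ S
    · simpa only [ofSelfDual_W_of_mem hsymm h2 hnd hex hΛ hsum S hS X hX hv] using h.1 v hv
    · simpa only [ofSelfDual_W_of_not_mem hsymm h2 hnd hex hΛ hsum S hS X hX hv] using h.2 v hv

end SelfDual

end Summit.BirchSwinnertonDyer.Rank1Residual.X10.TateQuadraticFormsOdd

end
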